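import Summits.BirchSwinnertonDyer.BirchSwinnertonDyer.Theorems.PrintCf2RamifiedOffTYZLowerHalfDoor
import Summits.BirchSwinnertonDyer.BirchSwinnertonDyer.Theorems.PrintCf2RamifiedOffTYZGaloisMotionDoorEven
import HarnessLib

/-!
# Route `PrintCf2`, crux stmt-BirchSwinnertonDyer-20509 `RamifiedOffTYZOfFacts` — THE EVEN CASE `n ≡ 6 (mod 8)` OF THE GENUS CHARACTER AND OF THE
# LOWER-HALF DOOR: for even `n` the torsion of `A(ℍ′_n)` is `A[4] = ⟨τ(1/2), ptQ⟩` (rational over `ℚ(i, √2)`), so every `g` fixing `i` and `√−2`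
# fixes it; on the stabiliser of `i, √−2, √−n` the cocycle `c_P` is a homomorphism, `𝓛(n)` odd ⟹ `c_P(g²) = χ_{Q₁}(g)`, a half-mover with
# silent square forces `2 ∣ 𝓛(n)`, a mover forces `4 ∤ 𝓛(n)`, and with both C⁺ at `n` is ONE Galois bit
# (cell `bsd-print-cf2`, LEAD of 20509 g11, line `offtyz-v7`, lineage cycle 12, even companion of `…GenusCharacter` / `…LowerHalfDoor`; fact-free, Theses-free, no `def`)

HONEST FRAMING (crux 20509, DECIDING, OPEN AS A CLASS): bookkeeping on Thm 3.5's displayed main clause and Lemma 3.18 (EVEN clause: every torsion point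
of `A(ℍ′_n)` is killed by `4`), the sixteen explicit `4`-torsion points of `CurveAFourTorsion` (`τ(1/2)`, `ptQ`, p-file of cell bsd-monsky /
W2), g3's `ρ`-free main clause, and this seat's odd files.  Nothing is asserted; C⁺ stays open.  What is NOT available for even `n` (g9/g10): a
Layer-1 SILENCE theorem (every square fixes `P(n)` at `s ≥ 2`) — so the even lower half stays a DOOR (hypothesis «`g₀²` fixes `P(n)`»), not a
digit theorem; the sectors concerned are E1/E2 of the jump-one class (`n = 2lq`).

* §1 (input, g5's `…GaloisMotionDoorEven`): `A[4] = ⟨τ(1/2), ptQ⟩` over `ℚ(i, √2)`, so for EVEN square-free `n` (Lemma 3.18) every `g ∈ Aut_ℚ(ℍ′_n)`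
  fixing `i` and `√−2` fixes every torsion point (`GaloisMotion.galPt_eq_self_of_isOfFinAddOrder_even`).
* §2 even versions of `…GenusCharacter` §2–§3 and `…LowerHalfDoor` §1–§2 on the stabiliser of `i, √−2, √−n`:
  `galPt_genusPoint_sub_mul_even`, `galPt_sq_genusPoint_sub_eq_galPt_half_sub_of_odd_scriptL_even` (**`𝓛(n)` odd ⟹ `g²·P(n) − P(n) = g·Q₁ − Q₁`**),
  `not_four_dvd_of_galPt_genusPoint_ne_even` (g4's upper-half door for even `n`), **`two_dvd_scriptL_of_halfMover_of_sq_eq_even`** (half-mover with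
  silent square ⟹ `2 ∣ 𝓛(n)`, `n ≡ 6 (8)`), and **`levelTwo_iff_galPt_genusPoint_ne_of_halfMover_of_sq_eq_even`** (then C⁺ at `n` ⟺ `g₀·P(n) ≠ P(n)`).

Beyond-print theorem: NO (doors; the even silence input is not in the tree).  BSD is not proved by any of this; no class is closed by this file.

References: [cite: TianYuanZhang2017, Thm. 3.5 (p0011 L94–L100), Lemma 3.16–3.18 (p0017 L98–L153), §3.1 (p0011 L27–L64)]; [cite: SilvermanAEC2009,
III.2.3, III.6.4, X.4.9]; [cite: Darmon2004, Thm. 3.22]; tree: `TianYuanZhang2017/CurveAFourTorsion` (`ptQ`, `card_four_torsion_eq_sixteen`,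
`injective_nsmul_add_nsmul_of_addOrderOf_four`), `…GaloisMotion`, `…GenusCharacter`, `…LowerHalfDoor`.
-/

noncomputable section

open scoped Classical

open WeierstrassCurve WeierstrassCurve.Affine Literature.NumberTheory.EllipticCurves
  Literature.NumberTheory.EllipticCurves.Rank1Residual Summit.BirchSwinnertonDyer.Rank1Residual
  Literature.NumberTheory.EllipticCurves.TianYuanZhang2017
  Literature.NumberTheory.EllipticCurves.TianYuanZhang2017.W2
  Summit.BirchSwinnertonDyer.PrintCf2.LevelTwoHalfGenerator
  Summit.BirchSwinnertonDyer.PrintCf2.GaloisMotion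
  Summit.BirchSwinnertonDyer.PrintCf2.LevelTwoHalves
  Summit.BirchSwinnertonDyer.PrintCf2.LevelTwoGenusQuotient
  Summit.BirchSwinnertonDyer.PrintCf2.GenusCharacter
  Summit.BirchSwinnertonDyer.PrintCf2.LowerHalfDoor
  Summit.BirchSwinnertonDyer.Rank1Residual.P2.ThetaDescent

set_option autoImplicit false

namespace Summit.BirchSwinnertonDyer.PrintCf2.LowerHalfDoorEven

variable {n : ℕ}

/-! ## §1 (The even torsion lemma `galPt_eq_self_of_isOfFinAddOrder_even` — `A[4] = ⟨τ(1/2), ptQ⟩` is fixed by every `g` fixing `i, √−2` —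
is g5's, `…GaloisMotionDoorEven`; it is reused here.) -/

/-! ## §2 The stabiliser of `i, √−2, √−n`: homomorphism, the identity at odd `𝓛`, and the two doors -/

/-- **`c_P(gh) = c_P(g) + c_P(h)`** for `g` fixing `i, √−2` and `h` fixing `√−n` (EVEN square-free `n`, rank `≤ 1`, `𝓛(n) ≠ 0`, Thm 3.5, Lemma 3.18).
[cite: TianYuanZhang2017, Thm. 3.5 (p0011 L94–L100), Lemma 3.18 (p0017 L152–L153)] -/
theorem galPt_genusPoint_sub_mul_even (hsq : Squarefree n) [(congruentNumberCurve n).IsElliptic] (heven : Even n)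
    (hr1 : (congruentNumberCurve n).mordellWeilRank ≤ 1) (D : GenusPointData n) (h35 : D.thm35Main)
    (hL0 : D.scriptL n ≠ 0) (h318 : D.lemma318) (g h : D.H ≃ₐ[ℚ] D.H) (hgi : g D.im = D.im) (hg2 : g (D.sqrtNeg 2) = D.sqrtNeg 2)
    (hhK : h (D.sqrtNeg n) = D.sqrtNeg n) :
    D.galPt (g * h) (D.P n) - D.P n = (D.galPt g (D.P n) - D.P n) + (D.galPt h (D.P n) - D.P n) := by
  have ht : IsOfFinAddOrder (D.galPt h (D.P n) - D.P n) :=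
    galPt_genusPoint_sub_isOfFinAddOrder hsq hr1 D h35 hL0 h hhK
  have hfix : D.galPt g (D.galPt h (D.P n) - D.P n) = D.galPt h (D.P n) - D.P n :=
    galPt_eq_self_of_isOfFinAddOrder_even D hsq.ne_zero heven h318 g hgi hg2 ht
  have e : D.galPt (g * h) (D.P n) = D.galPt g (D.galPt h (D.P n) - D.P n) + D.galPt g (D.P n) := by
    rw [Summit.BirchSwinnertonDyer.Rank1Residual.P2.GenusPeriodTransferLayer.galPt_mul, ← map_add, sub_add_cancel]
  rw [e, hfix]; abel

/-- **`2·c_P(g) = c_P(g²)`** for `g` fixing `i, √−2, √−n` (same data). [cite: TianYuanZhang2017, Thm. 3.5 (p0011 L94–L100), Lemma 3.18 (p0017 L152–L153)] -/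
theorem two_smul_galPt_genusPoint_sub_even (hsq : Squarefree n) [(congruentNumberCurve n).IsElliptic] (heven : Even n)
    (hr1 : (congruentNumberCurve n).mordellWeilRank ≤ 1) (D : GenusPointData n) (h35 : D.thm35Main)
    (hL0 : D.scriptL n ≠ 0) (h318 : D.lemma318) (g : D.H ≃ₐ[ℚ] D.H) (hgi : g D.im = D.im) (hg2 : g (D.sqrtNeg 2) = D.sqrtNeg 2)
    (hgK : g (D.sqrtNeg n) = D.sqrtNeg n) :
    (2 : ℕ) • (D.galPt g (D.P n) - D.P n) = D.galPt (g * g) (D.P n) - D.P n := by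
  rw [two_nsmul, galPt_genusPoint_sub_mul_even hsq heven hr1 D h35 hL0 h318 g g hgi hg2 hgK]

/-- **EVEN `n`, `𝓛(n)` ODD ⟹ `g²·P(n) − P(n) = g·Q₁ − Q₁`** for every `g` fixing `i, √−2, √−n` (square-free even `n`, rank `≤ 1`, Thm 3.5, Lemma 3.18;
`R`/`Q₁` as usual). [cite: TianYuanZhang2017, Thm. 3.5 (p0011 L94–L100), Lemma 3.18 (p0017 L152–L153)] -/
theorem galPt_sq_genusPoint_sub_eq_galPt_half_sub_of_odd_scriptL_even (hsq : Squarefree n) [(congruentNumberCurve n).IsElliptic]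
    (heven : Even n) (hr1 : (congruentNumberCurve n).mordellWeilRank ≤ 1) (D : GenusPointData n) (h35 : D.thm35Main)
    (h318 : D.lemma318) (hLodd : Odd (D.scriptL n))
    {R : (congruentNumberCurve n).toAffine.Point} (hR : ∀ x, ∃ k : ℤ, IsOfFinAddOrder (x - k • R))
    {Q₁ : APoint D.H} (hQ₁ : φH D Q₁ = Point.map (W' := curveA.twoIsogenyCodomain)
      (D.embK n (Nat.mem_divisors_self n hsq.ne_zero)) (ΘE hsq.ne_zero R))
    (g : D.H ≃ₐ[ℚ] D.H) (hgi : g D.im = D.im) (hg2 : g (D.sqrtNeg 2) = D.sqrtNeg 2) (hgK : g (D.sqrtNeg n) = D.sqrtNeg n) :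
    D.galPt (g * g) (D.P n) - D.P n = D.galPt g Q₁ - Q₁ := by
  have hn : n ∈ n.divisors := Nat.mem_divisors_self n hsq.ne_zero
  have hL0 : D.scriptL n ≠ 0 := by obtain ⟨j, hj⟩ := hLodd; omega
  obtain ⟨u, hu, hrel⟩ := two_smul_genusPoint_sub_smul_half_isOfFinAddOrder hsq hr1 D h35 hL0 hR hQ₁
  have hu2 : u * u = 1 := by rcases hu with rfl | rfl <;> norm_num
  obtain ⟨j, hj⟩ := hLodd
  have ht : IsOfFinAddOrder ((2 : ℤ) • (u • D.P n - j • Q₁) - Q₁) := by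
    have e : (2 : ℤ) • (u • D.P n - j • Q₁) - Q₁ = u • ((2 : ℤ) • D.P n - (u * D.scriptL n) • Q₁) := by
      rw [hj]
      rcases hu with rfl | rfl <;> module
    rw [e]
    exact hrel.zsmul
  have hfix : D.galPt g ((2 : ℤ) • (u • D.P n - j • Q₁) - Q₁) = (2 : ℤ) • (u • D.P n - j • Q₁) - Q₁ :=
    galPt_eq_self_of_isOfFinAddOrder_even D hsq.ne_zero heven h318 g hgi hg2 ht
  have h2χ : (2 : ℤ) • (D.galPt g Q₁ - Q₁) = 0 := by
    rcases galPt_half_sub_eq_zero_or_eq_tauOne D hn g hgK hQ₁ with e | e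
    · rw [e, smul_zero]
    · rw [e, two_zsmul, ← two_nsmul, two_nsmul_tauOne]
  have key : D.galPt g Q₁ - Q₁ = u • ((2 : ℤ) • (D.galPt g (D.P n) - D.P n)) := by
    have e1 : D.galPt g Q₁ - Q₁ =
        (2 : ℤ) • (u • (D.galPt g (D.P n) - D.P n)) - j • ((2 : ℤ) • (D.galPt g Q₁ - Q₁))
          - (D.galPt g ((2 : ℤ) • (u • D.P n - j • Q₁) - Q₁) - ((2 : ℤ) • (u • D.P n - j • Q₁) - Q₁)) := by
      rw [map_sub, map_zsmul, map_sub, map_zsmul, map_zsmul]; module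
    rw [e1, hfix, sub_self, sub_zero, h2χ, smul_zero, sub_zero]; module
  have hχneg : -(D.galPt g Q₁ - Q₁) = D.galPt g Q₁ - Q₁ := by
    rcases galPt_half_sub_eq_zero_or_eq_tauOne D hn g hgK hQ₁ with e | e
    · rw [e, neg_zero]
    · rw [e, neg_eq_iff_add_eq_zero, ← two_nsmul, two_nsmul_tauOne]
  have hx : (2 : ℤ) • (D.galPt g (D.P n) - D.P n) = u • (D.galPt g Q₁ - Q₁) := by
    rw [key, smul_smul, hu2, one_smul]
  rw [← two_smul_galPt_genusPoint_sub_even hsq heven hr1 D h35 hL0 h318 g hgi hg2 hgK, ← ofNat_zsmul, hx]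
  rcases hu with rfl | rfl
  · rw [one_smul]
  · rw [neg_one_smul, hχneg]

/-- **THE UPPER-HALF DOOR FOR EVEN `n`** (g4's `not_four_dvd_of_galPt_genusPoint_ne` with the even torsion lemma): square-free `n ≡ 6 (mod 8)` of
analytic rank one, GZK, Thm 3.5, integrality, Lemma 3.18; a `g ∈ Aut_ℚ(ℍ′_n)` fixing `i`, `√−2`, `√−n` with `g·P(n) ≠ P(n)` forces `4 ∤ L` for every
`L` with `𝓛(n)² = L²`. [cite: TianYuanZhang2017, Thm. 3.5 (p0011 L94–L100), Lemma 3.18 (p0017 L152–L153)] [cite: Darmon2004, Thm. 3.22] -/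
theorem not_four_dvd_of_galPt_genusPoint_ne_even
    (hGZK : rank_eq_analyticRank_of_analyticRank_le_one) (hsq : Squarefree n)
    (h6 : n % 8 = 6) (hr : (congruentNumberCurve n).analyticRank = 1)
    (D : GenusPointData n) (h35 : D.thm35Main) (hLs : D.scriptLSpec) (h318 : D.lemma318)
    (g : D.H ≃ₐ[ℚ] D.H) (hgi : g D.im = D.im) (hg2 : g (D.sqrtNeg 2) = D.sqrtNeg 2) (hgK : g (D.sqrtNeg n) = D.sqrtNeg n)
    (hmove : D.galPt g (D.P n) ≠ D.P n) :
    ∀ L : ℤ, IsScriptL n L → ¬ (4 : ℤ) ∣ L := by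
  haveI := isElliptic_congruentNumberCurve hsq.ne_zero
  have heven : Even n := Nat.even_iff.mpr (by omega)
  have hn : n ∈ n.divisors := Nat.mem_divisors_self n hsq.ne_zero
  have hn1 : 1 < n := by omega
  have hLD : IsScriptL n (D.scriptL n) := hLs n hn hn1
  have hL0 : D.scriptL n ≠ 0 := (P2.bsdp_two_congruentNumberCurve_iff_of_isScriptL hGZK hsq hr hLD).2.2.1
  have hrank : (congruentNumberCurve n).mordellWeilRank = 1 := (hGZK _ hr.le).1.trans hr
  obtain ⟨R, hR⟩ := stub_S0 (n := n) hrank.le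
  obtain ⟨Q₁, hQ₁⟩ := twist_halving hsq hn D R
  obtain ⟨u, hu, hrel⟩ := two_smul_genusPoint_sub_smul_half_isOfFinAddOrder hsq hrank.le D h35 hL0 hR hQ₁
  intro L hL h4
  have h4' : (4 : ℤ) ∣ D.scriptL n := by
    rcases LevelTwo.eq_or_eq_neg_of_isScriptL hL hLD with e | e
    · rwa [← e]
    · rw [← dvd_neg, ← e]; exact h4
  obtain ⟨c, hc⟩ := h4'
  have ht : IsOfFinAddOrder (D.P n - (u * c) • ((2 : ℤ) • Q₁)) := by
    have e : (2 : ℤ) • D.P n - (u * D.scriptL n) • Q₁ = (2 : ℤ) • (D.P n - (u * c) • ((2 : ℤ) • Q₁)) := by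
      rw [hc]; module
    rw [e] at hrel
    exact LevelTwo.isOfFinAddOrder_of_zsmul two_ne_zero hrel
  apply hmove
  have eP : D.P n = (D.P n - (u * c) • ((2 : ℤ) • Q₁)) + (u * c) • ((2 : ℤ) • Q₁) := by abel
  have hV : D.galPt g ((u * c) • ((2 : ℤ) • Q₁)) = (u * c) • ((2 : ℤ) • Q₁) := by
    rw [map_zsmul, galPt_two_smul_half_eq D hn g hgK hQ₁]
  rw [eP, map_add, galPt_eq_self_of_isOfFinAddOrder_even D hsq.ne_zero heven h318 g hgi hg2 ht, hV]

/-- **THE LOWER-HALF DOOR FOR EVEN `n`**: square-free `n ≡ 6 (mod 8)` of analytic rank one, GZK, Thm 3.5, integrality, Lemma 3.18; `R` a generator of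
`E_n(ℚ)` mod torsion, `Q₁` a half of its twist; a HALF-MOVER `g₀` (fixing `i`, `√−2`, `√−n`, moving `Q₁`) whose SQUARE fixes `P(n)` forces `2 ∣ L`
for every `L` with `𝓛(n)² = L²`. [cite: TianYuanZhang2017, Thm. 3.5 (p0011 L94–L100), Lemma 3.18 (p0017 L152–L153)] [cite: Darmon2004, Thm. 3.22] -/
theorem two_dvd_scriptL_of_halfMover_of_sq_eq_even
    (hGZK : rank_eq_analyticRank_of_analyticRank_le_one) (hsq : Squarefree n)
    (h6 : n % 8 = 6) (hr : (congruentNumberCurve n).analyticRank = 1)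
    (D : GenusPointData n) (h35 : D.thm35Main) (hLs : D.scriptLSpec) (h318 : D.lemma318)
    {R : (congruentNumberCurve n).toAffine.Point} (hR : ∀ x, ∃ k : ℤ, IsOfFinAddOrder (x - k • R))
    {Q₁ : APoint D.H} (hQ₁ : φH D Q₁ = Point.map (W' := curveA.twoIsogenyCodomain)
      (D.embK n (Nat.mem_divisors_self n hsq.ne_zero)) (ΘE hsq.ne_zero R))
    (g₀ : D.H ≃ₐ[ℚ] D.H) (hgi : g₀ D.im = D.im) (hg2 : g₀ (D.sqrtNeg 2) = D.sqrtNeg 2) (hgK : g₀ (D.sqrtNeg n) = D.sqrtNeg n)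
    (hmoveQ : D.galPt g₀ Q₁ ≠ Q₁) (hsq0 : D.galPt (g₀ * g₀) (D.P n) = D.P n) :
    ∀ L : ℤ, IsScriptL n L → (2 : ℤ) ∣ L := by
  haveI := isElliptic_congruentNumberCurve hsq.ne_zero
  have heven : Even n := Nat.even_iff.mpr (by omega)
  have hn : n ∈ n.divisors := Nat.mem_divisors_self n hsq.ne_zero
  have hn1 : 1 < n := by omega
  have hLD : IsScriptL n (D.scriptL n) := hLs n hn hn1
  have hrank : (congruentNumberCurve n).mordellWeilRank = 1 := (hGZK _ hr.le).1.trans hr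
  have h2 : (2 : ℤ) ∣ D.scriptL n := by
    by_contra hnot
    have hLodd : Odd (D.scriptL n) := Int.not_even_iff_odd.mp (fun h => hnot (even_iff_two_dvd.mp h))
    apply hmoveQ
    have key := galPt_sq_genusPoint_sub_eq_galPt_half_sub_of_odd_scriptL_even hsq heven hrank.le D h35 h318 hLodd hR hQ₁ g₀ hgi hg2 hgK
    rw [hsq0, sub_self] at key
    exact (sub_eq_zero.mp key.symm)
  intro L hL
  rcases LevelTwo.eq_or_eq_neg_of_isScriptL hL hLD with rfl | rfl
  · exact h2
  · exact (dvd_neg).mpr h2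

/-- **EVEN `n`, HALF-MOVER WITH SILENT SQUARE: C⁺ AT `n` ⟺ ONE BIT** (same data): the conclusion of C⁺ at `n` holds iff `g₀·P(n) ≠ P(n)` (on the line
`P(n) ≡ m·Q₁` given by the lower half, `c_P(g₀) = m·χ_{Q₁}(g₀)` with the even torsion lemma; upper half by the even door).
[cite: TianYuanZhang2017, Thm. 3.5 (p0011 L94–L100), Lemma 3.18 (p0017 L152–L153)] [cite: Darmon2004, Thm. 3.22] -/
theorem levelTwo_iff_galPt_genusPoint_ne_of_halfMover_of_sq_eq_even
    (hGZK : rank_eq_analyticRank_of_analyticRank_le_one) (hsq : Squarefree n)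
    (h6 : n % 8 = 6) (hr : (congruentNumberCurve n).analyticRank = 1)
    (D : GenusPointData n) (h35 : D.thm35Main) (hLs : D.scriptLSpec) (h318 : D.lemma318)
    {R : (congruentNumberCurve n).toAffine.Point} (hR : ∀ x, ∃ k : ℤ, IsOfFinAddOrder (x - k • R))
    {Q₁ : APoint D.H} (hQ₁ : φH D Q₁ = Point.map (W' := curveA.twoIsogenyCodomain)
      (D.embK n (Nat.mem_divisors_self n hsq.ne_zero)) (ΘE hsq.ne_zero R))
    (g₀ : D.H ≃ₐ[ℚ] D.H) (hgi : g₀ D.im = D.im) (hg2 : g₀ (D.sqrtNeg 2) = D.sqrtNeg 2) (hgK : g₀ (D.sqrtNeg n) = D.sqrtNeg n)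
    (hmoveQ : D.galPt g₀ Q₁ ≠ Q₁) (hsq0 : D.galPt (g₀ * g₀) (D.P n) = D.P n) :
    (∀ L : ℤ, IsScriptL n L → (2 : ℤ) ∣ L ∧ ¬ (4 : ℤ) ∣ L) ↔ D.galPt g₀ (D.P n) ≠ D.P n := by
  haveI := isElliptic_congruentNumberCurve hsq.ne_zero
  have heven : Even n := Nat.even_iff.mpr (by omega)
  have h8 : n % 8 = 5 ∨ n % 8 = 6 ∨ n % 8 = 7 := Or.inr (Or.inl h6)
  have hn : n ∈ n.divisors := Nat.mem_divisors_self n hsq.ne_zero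
  have h2 := two_dvd_scriptL_of_halfMover_of_sq_eq_even hGZK hsq h6 hr D h35 hLs h318 hR hQ₁ g₀ hgi hg2 hgK hmoveQ hsq0
  constructor
  · intro hC hP
    -- `P ≡ m·Q₁` with `m` odd, so `c_P(g₀) = χ(g₀) ≠ 0`
    obtain ⟨m, hmo, hm⟩ := (levelTwo_iff_genusPoint_odd_multiple_half hGZK hsq h8 hr D h35 hLs hR hQ₁).mp hC
    have hfix := galPt_eq_self_of_isOfFinAddOrder_even D hsq.ne_zero heven h318 g₀ hgi hg2 hm
    have hc : D.galPt g₀ (D.P n) - D.P n = m • (D.galPt g₀ Q₁ - Q₁) := by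
      have e : D.P n = (D.P n - m • Q₁) + m • Q₁ := by abel
      conv_lhs => rw [e, map_add, hfix, map_zsmul]
      rw [e]
      module
    obtain ⟨j, rfl⟩ := hmo
    have hχ2 : (j + j) • (D.galPt g₀ Q₁ - Q₁) = 0 := by
      rcases galPt_half_sub_eq_zero_or_eq_tauOne D hn g₀ hgK hQ₁ with e | e
      · rw [e, smul_zero]
      · rw [e, ← two_mul, mul_comm, mul_smul, two_zsmul, ← two_nsmul, two_nsmul_tauOne, smul_zero]
    rw [hP, sub_self, show (2 * j + 1) • (D.galPt g₀ Q₁ - Q₁) = (j + j) • (D.galPt g₀ Q₁ - Q₁) + (D.galPt g₀ Q₁ - Q₁) by module,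
      hχ2, zero_add] at hc
    exact hmoveQ (sub_eq_zero.mp hc.symm)
  · intro hmove L hL
    exact ⟨h2 L hL, not_four_dvd_of_galPt_genusPoint_ne_even hGZK hsq h6 hr D h35 hLs h318 g₀ hgi hg2 hgK hmove L hL⟩

end Summit.BirchSwinnertonDyer.PrintCf2.LowerHalfDoorEven

end
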